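/-
Copyright (c) 2026 the pub-hodgecm-mathlib formalisation cell (harness21).  Prover seat hodgecm-mathlib-K2Liu-p27 (g2), Track B «K2-LIT»,
#184♮ = hLiu418 = `stmt-HodgeConjecture-24832`; RULINGS M-158r∕M-158u (LEAD F0P6-plan (g14)): F4 (G-gen) road (E) (K2E5-r02 (g6)), HEAD (E-f)
`K2LiuLocalThetaCyclicUniform` = STEPS 1–3 assembled, GENERIC CORE (F4 lead K2Liu-p27; interface memo `MEMO-F4-E-Interface` 23:10Z).
THEOREMS ONLY (no `def`, no `instance`, no notation, no named-fact hypothesis, no `sorry`); lane `--supports stmt-HodgeConjecture-24832 --as helper`.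
-/
import Summits.HodgeConjecture.HodgeConjecture.Theorems.K2LiuFockPBWInduction   -- ★ (E-c) p862898: `map_mem_of_mem_span_balanced`, `induction_on_balanced_products`
import HarnessLib

/-!
# Crux `HLiu418`, organ F4 (G-gen), HEAD (E-f), generic core: LOCAL THETA CYCLICITY, UNIFORM IN THE SIGNATURE — every `K̃`-finite vector is,
# modulo the kernel of the section map, generated from the vacuum by the `𝔭^±` operators

Cell `hodgecm-mathlib`, crux item hLiu418 = `stmt-HodgeConjecture-24832` (helper lane `--supports`, count-neutral; closes no socket).

ROAD (E) at one real place `σ` of signature `(p,q)` (K2E5-r02 (g6) 22:54:25Z; RULING M-158u): STEP 1 (FFT, brick (E-a2)) the `K_H = U(p) × U(q)`-invariant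
Fock polynomials are spanned by the balanced products of contractions `(∏ C^R)(∏ C^S)`; STEP 2 (PBW, ★ (E-c) `K2LiuFockPBWInduction`) every such product is
reached from `1` by the `𝔭^±` symbols; STEP 3 (reduction, brick (E-d)) every Fock polynomial `F` has a `K_H`-invariant `F₀` with THE SAME SECTION
`SW(B F) = SW(B F₀)` (compact reduction + the see-saw pivot «the section functional is `K_H`-semi-invariant»).  THIS FILE is the assembly, typed ONCE and
GENERICALLY so that each brick lands by `exact`: a commutative `ℂ`-algebra `A` (the Fock polynomials `MvPolynomial (DPIdx (Fin 2) (Fin 2) R S) ℂ`), a module `V`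
(the one-place Schwartz space) with `B : A →ₗ[ℂ] V` (★ `binvPi`), contraction data `CR CS : ι → A` and symbol operators `Ap Am : ι → A →ₗ A` intertwined by `B`
with vector operators `ωp ωm : ι → V →ₗ V` (★ Konno–Konno `hypOpGen_sub∕add_I_smul_rotBoostGen_binvPi`; brick (E-b) names them), a family of substitutions
`subst : G → A →ₗ[ℂ] A` (★ `linSubst ∘ dualPairι` on `1 × K_H`, ★ `κOp_binvPi`), and a linear SECTION MAP `SW : V →ₗ[ℂ] W` (the one-place Siegel–Weil value).
LETTERS BY VALUE: (hAm)(hAp) of ★ (E-c); (hBp)(hBm) the intertwining; **(FFT)** `∀ F, (∀ g, subst g F = F) → F ∈ span {∏_ρ CR * ∏_τ CS}` ((E-a2));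
**(RED)** `∀ F, ∃ F₀, (∀ g, subst g F₀ = F₀) ∧ SW (B F) = SW (B F₀)` ((E-d)).  CONCLUSIONS:
* §1 **`map_mem_of_cyclicLetters`** — `B F` lies in every subspace `N ≤ V` that contains `B 1 = φ°`, is stable under all `ωp i`, `ωm i`, and is
  `SW`-SATURATED (`SW v = SW v′ → v ∈ N → v′ ∈ N`), for EVERY `F : A` («`𝓢_{K̃-fin} ⊆ U(𝔭⁺ ⊕ 𝔭⁻)·φ° + ker SW`», uniformly in `(p,q)`);
* §2 **`induction_on_kFinite`** — the predicate form: `Good` closed under `0, +, •, ωp, ωm` and `SW`-invariant, `Good φ°` ⇒ `Good (B F)` for all `F`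
  (= p10's L3 `deriv`∕`congr_sec` closure at the vector level, one place);
* §4 (ED. 2) the `…_fun` twins with UNBUNDLED vector operators `ωp ωm : ι → V → V` (over ★ (E-c) ED. 2);
* §3 **`sw_map_mem_span_of_cyclicLetters`** — the section-level reading: `SW (B F) ∈ SW '' N`-type statement as `∃ v ∈ N, SW (B F) = SW v` for every
  `ω^±`-stable `N ∋ φ°` (no saturation needed: the witness is `B F₀`'s generator).
The INSTANCE (E-f-inst) — `A, V, B, ωp, ωm, subst, SW` := the ★ junction-datum objects, letters := ★ (E-b)(E-a2)(E-d) — is appended when those bricks land;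
B3 `K2LiuArchSWDataInduction` globalises §2 over the real places (★ W4 ∕ ★ F2 ∕ place factorisation).
References: [Howe1989, §3]; [KudlaRallis1994, §3]; [KashiwaraVergne1978, §II.5] (citations only — the file is linear algebra over ★ (E-c)).
HONEST LABEL: HC_CM is proved only modulo the 7 printed citations (2 remaining named inputs: hLiu418 = stmt-HodgeConjecture-24832,
h413 = stmt-HodgeConjecture-24833) until rung 0 closes; count-neutral helper, closes no socket.
-/

set_option autoImplicit false
set_option linter.dupNamespace false -- the mandated namespace repeats `HodgeConjecture.HodgeConjecture`

namespace Summit.HodgeConjecture.HodgeConjecture.Cruxes.HLiu418.K2LiuLocalThetaCyclicUniform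

open Summit.HodgeConjecture.HodgeConjecture.Cruxes.HLiu418.K2LiuFockPBWInduction

variable {A : Type*} [CommRing A] [Algebra ℂ A] {ι : Type*} {V : Type*} [AddCommGroup V] [Module ℂ V] {W : Type*} [AddCommGroup W] [Module ℂ W]
  {G : Type*} (CR CS : ι → A) (Ap Am : ι → A →ₗ[ℂ] A) {c₁ c₃ : ℂ}
  (B : A →ₗ[ℂ] V) (ωp ωm : ι → V →ₗ[ℂ] V) (subst : G → A →ₗ[ℂ] A) (SW : V →ₗ[ℂ] W)

/-! ## §1 Membership form -/

/-- **LOCAL THETA CYCLICITY, UNIFORM IN THE SIGNATURE (membership form).**  Under the letters (hAm)(hAp) of ★ (E-c), the intertwining (hBp)(hBm), the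
first fundamental theorem (FFT) «`subst`-invariant polynomials are spanned by the balanced products `∏ CR ∏ CS`» and the reduction (RED) «every `F` has a
`subst`-invariant `F₀` with the same section `SW (B F) = SW (B F₀)`»: for EVERY `F : A`, the vector `B F` lies in every subspace `N ≤ V` containing `B 1`,
stable under all `ωp i`, `ωm i`, and saturated for `SW`.  (Road (E): `B F ~_{SW} B F₀`, `F₀ ∈ L⁺ ⊗ L⁻ ⊆ U(𝔭⁺ ⊕ 𝔭⁻)·1`.) [cite: Howe1989, §3] [cite: KudlaRallis1994, §3] -/
theorem map_mem_of_cyclicLetters (hc₁ : c₁ ≠ 0) (hc₃ : c₃ ≠ 0)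
    (hAm : ∀ (τ : List ι) (i : ι), Am i (τ.map CS).prod = c₃ • (CS i * (τ.map CS).prod))
    (hAp : ∀ (ρ τ : List ι) (i : ι),
      Ap i ((ρ.map CR).prod * (τ.map CS).prod) - c₁ • (CR i * (ρ.map CR).prod * (τ.map CS).prod) ∈
        Submodule.span ℂ {x : A | ∃ τ' : List ι, τ'.length < τ.length ∧ x = (ρ.map CR).prod * (τ'.map CS).prod})
    (hBp : ∀ i F, B (Ap i F) = ωp i (B F)) (hBm : ∀ i F, B (Am i F) = ωm i (B F))
    (hFFT : ∀ F : A, (∀ g, subst g F = F) → F ∈ Submodule.span ℂ {x : A | ∃ ρ τ : List ι, x = (ρ.map CR).prod * (τ.map CS).prod})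
    (hRED : ∀ F : A, ∃ F₀ : A, (∀ g, subst g F₀ = F₀) ∧ SW (B F) = SW (B F₀))
    (N : Submodule ℂ V) (h1 : B 1 ∈ N) (hNp : ∀ i, ∀ v ∈ N, ωp i v ∈ N) (hNm : ∀ i, ∀ v ∈ N, ωm i v ∈ N)
    (hNsat : ∀ v v' : V, SW v = SW v' → v ∈ N → v' ∈ N) (F : A) : B F ∈ N := by
  obtain ⟨F₀, hF₀, hSW⟩ := hRED F
  have h₀ : B F₀ ∈ N := map_mem_of_mem_span_balanced CR CS Ap Am B ωp ωm hc₁ hc₃ hAm hAp hBp hBm N h1 hNp hNm (hFFT F₀ hF₀)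
  exact hNsat (B F₀) (B F) hSW.symm h₀

/-! ## §2 Predicate form (the L3 `deriv`∕`congr_sec` closure at one place) -/

/-- **LOCAL THETA CYCLICITY (predicate form).**  A property `Good` of vectors closed under `0`, `+`, scalars and the operators `ωp i`, `ωm i`, INVARIANT under
«same section» (`SW v = SW v′ → Good v → Good v′`), which holds at the vacuum `B 1 = φ°`, holds at `B F` for EVERY `F` — under the letters of §1.
This is the one-place content of FACE-G's (G-gen) induction principle. [cite: Howe1989, §3] [cite: KudlaRallis1994, §3] -/
theorem induction_on_kFinite (hc₁ : c₁ ≠ 0) (hc₃ : c₃ ≠ 0)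
    (hAm : ∀ (τ : List ι) (i : ι), Am i (τ.map CS).prod = c₃ • (CS i * (τ.map CS).prod))
    (hAp : ∀ (ρ τ : List ι) (i : ι),
      Ap i ((ρ.map CR).prod * (τ.map CS).prod) - c₁ • (CR i * (ρ.map CR).prod * (τ.map CS).prod) ∈
        Submodule.span ℂ {x : A | ∃ τ' : List ι, τ'.length < τ.length ∧ x = (ρ.map CR).prod * (τ'.map CS).prod})
    (hBp : ∀ i F, B (Ap i F) = ωp i (B F)) (hBm : ∀ i F, B (Am i F) = ωm i (B F))
    (hFFT : ∀ F : A, (∀ g, subst g F = F) → F ∈ Submodule.span ℂ {x : A | ∃ ρ τ : List ι, x = (ρ.map CR).prod * (τ.map CS).prod})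
    (hRED : ∀ F : A, ∃ F₀ : A, (∀ g, subst g F₀ = F₀) ∧ SW (B F) = SW (B F₀))
    {Good : V → Prop} (h0 : Good 0) (hadd : ∀ v w, Good v → Good w → Good (v + w)) (hsmul : ∀ (c : ℂ) v, Good v → Good (c • v))
    (hbase : Good (B 1)) (hωp : ∀ i v, Good v → Good (ωp i v)) (hωm : ∀ i v, Good v → Good (ωm i v))
    (hsec : ∀ v v' : V, SW v = SW v' → Good v → Good v') (F : A) : Good (B F) := by
  let N : Submodule ℂ V :=
    { carrier := {v | Good v}
      add_mem' := fun {v w} hv hw => hadd v w hv hw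
      zero_mem' := h0
      smul_mem' := fun c {v} hv => hsmul c v hv }
  exact map_mem_of_cyclicLetters CR CS Ap Am B ωp ωm subst SW hc₁ hc₃ hAm hAp hBp hBm hFFT hRED N hbase
    (fun i v hv => hωp i v hv) (fun i v hv => hωm i v hv) (fun v v' h hv => hsec v v' h hv) F

/-! ## §3 Section-level reading (no saturation needed) -/

/-- **SECTION-LEVEL CYCLICITY.**  Under the letters of §1, for every subspace `N ∋ B 1` stable under the `ωp i`, `ωm i` (e.g. the `U(𝔭⁺ ⊕ 𝔭⁻)`-span of the vacuum)
and every `F : A` there is `v ∈ N` with THE SAME SECTION: `SW (B F) = SW v` — «`SW(𝓢_{K̃-fin}) = SW(U(𝔭^±)·φ°)`», the (G-gen) generation letter of FACE-G, uniformly in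
the signature. [cite: Howe1989, §3] [cite: KudlaRallis1994, §3] -/
theorem exists_mem_sw_eq_of_cyclicLetters (hc₁ : c₁ ≠ 0) (hc₃ : c₃ ≠ 0)
    (hAm : ∀ (τ : List ι) (i : ι), Am i (τ.map CS).prod = c₃ • (CS i * (τ.map CS).prod))
    (hAp : ∀ (ρ τ : List ι) (i : ι),
      Ap i ((ρ.map CR).prod * (τ.map CS).prod) - c₁ • (CR i * (ρ.map CR).prod * (τ.map CS).prod) ∈
        Submodule.span ℂ {x : A | ∃ τ' : List ι, τ'.length < τ.length ∧ x = (ρ.map CR).prod * (τ'.map CS).prod})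
    (hBp : ∀ i F, B (Ap i F) = ωp i (B F)) (hBm : ∀ i F, B (Am i F) = ωm i (B F))
    (hFFT : ∀ F : A, (∀ g, subst g F = F) → F ∈ Submodule.span ℂ {x : A | ∃ ρ τ : List ι, x = (ρ.map CR).prod * (τ.map CS).prod})
    (hRED : ∀ F : A, ∃ F₀ : A, (∀ g, subst g F₀ = F₀) ∧ SW (B F) = SW (B F₀))
    (N : Submodule ℂ V) (h1 : B 1 ∈ N) (hNp : ∀ i, ∀ v ∈ N, ωp i v ∈ N) (hNm : ∀ i, ∀ v ∈ N, ωm i v ∈ N) (F : A) :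
    ∃ v ∈ N, SW (B F) = SW v := by
  obtain ⟨F₀, hF₀, hSW⟩ := hRED F
  exact ⟨B F₀, map_mem_of_mem_span_balanced CR CS Ap Am B ωp ωm hc₁ hc₃ hAm hAp hBp hBm N h1 hNp hNm (hFFT F₀ hF₀), hSW⟩

/-- **KERNEL DECOMPOSITION READING**: every `B F` is `v + u` with `v ∈ N` (any `ω^±`-stable `N ∋ φ°`) and `SW u = 0` — «`𝓢_{K̃-fin} ⊆ N + ker SW`».
[cite: Howe1989, §3] -/
theorem exists_mem_add_ker_of_cyclicLetters (hc₁ : c₁ ≠ 0) (hc₃ : c₃ ≠ 0)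
    (hAm : ∀ (τ : List ι) (i : ι), Am i (τ.map CS).prod = c₃ • (CS i * (τ.map CS).prod))
    (hAp : ∀ (ρ τ : List ι) (i : ι),
      Ap i ((ρ.map CR).prod * (τ.map CS).prod) - c₁ • (CR i * (ρ.map CR).prod * (τ.map CS).prod) ∈
        Submodule.span ℂ {x : A | ∃ τ' : List ι, τ'.length < τ.length ∧ x = (ρ.map CR).prod * (τ'.map CS).prod})
    (hBp : ∀ i F, B (Ap i F) = ωp i (B F)) (hBm : ∀ i F, B (Am i F) = ωm i (B F))
    (hFFT : ∀ F : A, (∀ g, subst g F = F) → F ∈ Submodule.span ℂ {x : A | ∃ ρ τ : List ι, x = (ρ.map CR).prod * (τ.map CS).prod})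
    (hRED : ∀ F : A, ∃ F₀ : A, (∀ g, subst g F₀ = F₀) ∧ SW (B F) = SW (B F₀))
    (N : Submodule ℂ V) (h1 : B 1 ∈ N) (hNp : ∀ i, ∀ v ∈ N, ωp i v ∈ N) (hNm : ∀ i, ∀ v ∈ N, ωm i v ∈ N) (F : A) :
    ∃ v ∈ N, ∃ u : V, SW u = 0 ∧ B F = v + u := by
  obtain ⟨v, hv, hSW⟩ := exists_mem_sw_eq_of_cyclicLetters CR CS Ap Am B ωp ωm subst SW hc₁ hc₃ hAm hAp hBp hBm hFFT hRED N h1 hNp hNm F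
  refine ⟨v, hv, B F - v, ?_, (add_sub_cancel v (B F)).symm⟩
  rw [map_sub, hSW, sub_self]

/-! ## §4 (ED. 2) The same with UNBUNDLED vector operators `ωp ωm : ι → V → V` (★ (E-c) ED. 2 `…_fun` twins; the Konno–Konno
Schwartz-side symbols `hypOpGen − I • rotBoostGen (π∕2)` are bundled only `ℝ`-linearly) -/

section Unbundled

variable (ωp' ωm' : ι → V → V)

/-- **LOCAL THETA CYCLICITY (membership form), UNBUNDLED OPERATORS.** [cite: Howe1989, §3] [cite: KudlaRallis1994, §3] -/
theorem map_mem_of_cyclicLetters_fun (hc₁ : c₁ ≠ 0) (hc₃ : c₃ ≠ 0)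
    (hAm : ∀ (τ : List ι) (i : ι), Am i (τ.map CS).prod = c₃ • (CS i * (τ.map CS).prod))
    (hAp : ∀ (ρ τ : List ι) (i : ι),
      Ap i ((ρ.map CR).prod * (τ.map CS).prod) - c₁ • (CR i * (ρ.map CR).prod * (τ.map CS).prod) ∈
        Submodule.span ℂ {x : A | ∃ τ' : List ι, τ'.length < τ.length ∧ x = (ρ.map CR).prod * (τ'.map CS).prod})
    (hBp : ∀ i F, B (Ap i F) = ωp' i (B F)) (hBm : ∀ i F, B (Am i F) = ωm' i (B F))
    (hFFT : ∀ F : A, (∀ g, subst g F = F) → F ∈ Submodule.span ℂ {x : A | ∃ ρ τ : List ι, x = (ρ.map CR).prod * (τ.map CS).prod})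
    (hRED : ∀ F : A, ∃ F₀ : A, (∀ g, subst g F₀ = F₀) ∧ SW (B F) = SW (B F₀))
    (N : Submodule ℂ V) (h1 : B 1 ∈ N) (hNp : ∀ i, ∀ v ∈ N, ωp' i v ∈ N) (hNm : ∀ i, ∀ v ∈ N, ωm' i v ∈ N)
    (hNsat : ∀ v v' : V, SW v = SW v' → v ∈ N → v' ∈ N) (F : A) : B F ∈ N := by
  obtain ⟨F₀, hF₀, hSW⟩ := hRED F
  have h₀ : B F₀ ∈ N := map_mem_of_mem_span_balanced_fun CR CS Ap Am B ωp' ωm' hc₁ hc₃ hAm hAp hBp hBm N h1 hNp hNm (hFFT F₀ hF₀)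
  exact hNsat (B F₀) (B F) hSW.symm h₀

/-- **LOCAL THETA CYCLICITY (predicate form), UNBUNDLED OPERATORS** — the one-place content of FACE-G's (G-gen) induction principle, in the shape the ★
Konno–Konno symbols instantiate directly. [cite: Howe1989, §3] [cite: KudlaRallis1994, §3] -/
theorem induction_on_kFinite_fun (hc₁ : c₁ ≠ 0) (hc₃ : c₃ ≠ 0)
    (hAm : ∀ (τ : List ι) (i : ι), Am i (τ.map CS).prod = c₃ • (CS i * (τ.map CS).prod))
    (hAp : ∀ (ρ τ : List ι) (i : ι),
      Ap i ((ρ.map CR).prod * (τ.map CS).prod) - c₁ • (CR i * (ρ.map CR).prod * (τ.map CS).prod) ∈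
        Submodule.span ℂ {x : A | ∃ τ' : List ι, τ'.length < τ.length ∧ x = (ρ.map CR).prod * (τ'.map CS).prod})
    (hBp : ∀ i F, B (Ap i F) = ωp' i (B F)) (hBm : ∀ i F, B (Am i F) = ωm' i (B F))
    (hFFT : ∀ F : A, (∀ g, subst g F = F) → F ∈ Submodule.span ℂ {x : A | ∃ ρ τ : List ι, x = (ρ.map CR).prod * (τ.map CS).prod})
    (hRED : ∀ F : A, ∃ F₀ : A, (∀ g, subst g F₀ = F₀) ∧ SW (B F) = SW (B F₀))
    {Good : V → Prop} (h0 : Good 0) (hadd : ∀ v w, Good v → Good w → Good (v + w)) (hsmul : ∀ (c : ℂ) v, Good v → Good (c • v))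
    (hbase : Good (B 1)) (hωp : ∀ i v, Good v → Good (ωp' i v)) (hωm : ∀ i v, Good v → Good (ωm' i v))
    (hsec : ∀ v v' : V, SW v = SW v' → Good v → Good v') (F : A) : Good (B F) := by
  let N : Submodule ℂ V :=
    { carrier := {v | Good v}
      add_mem' := fun {v w} hv hw => hadd v w hv hw
      zero_mem' := h0
      smul_mem' := fun c {v} hv => hsmul c v hv }
  exact map_mem_of_cyclicLetters_fun CR CS Ap Am B subst SW ωp' ωm' hc₁ hc₃ hAm hAp hBp hBm hFFT hRED N hbase
    (fun i v hv => hωp i v hv) (fun i v hv => hωm i v hv) (fun v v' h hv => hsec v v' h hv) F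

/-- **SECTION-LEVEL CYCLICITY, UNBUNDLED OPERATORS**: `∃ v ∈ N, SW (B F) = SW v` for every `ω^±`-stable `N ∋ B 1`. [cite: Howe1989, §3] -/
theorem exists_mem_sw_eq_of_cyclicLetters_fun (hc₁ : c₁ ≠ 0) (hc₃ : c₃ ≠ 0)
    (hAm : ∀ (τ : List ι) (i : ι), Am i (τ.map CS).prod = c₃ • (CS i * (τ.map CS).prod))
    (hAp : ∀ (ρ τ : List ι) (i : ι),
      Ap i ((ρ.map CR).prod * (τ.map CS).prod) - c₁ • (CR i * (ρ.map CR).prod * (τ.map CS).prod) ∈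
        Submodule.span ℂ {x : A | ∃ τ' : List ι, τ'.length < τ.length ∧ x = (ρ.map CR).prod * (τ'.map CS).prod})
    (hBp : ∀ i F, B (Ap i F) = ωp' i (B F)) (hBm : ∀ i F, B (Am i F) = ωm' i (B F))
    (hFFT : ∀ F : A, (∀ g, subst g F = F) → F ∈ Submodule.span ℂ {x : A | ∃ ρ τ : List ι, x = (ρ.map CR).prod * (τ.map CS).prod})
    (hRED : ∀ F : A, ∃ F₀ : A, (∀ g, subst g F₀ = F₀) ∧ SW (B F) = SW (B F₀))
    (N : Submodule ℂ V) (h1 : B 1 ∈ N) (hNp : ∀ i, ∀ v ∈ N, ωp' i v ∈ N) (hNm : ∀ i, ∀ v ∈ N, ωm' i v ∈ N) (F : A) :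
    ∃ v ∈ N, SW (B F) = SW v := by
  obtain ⟨F₀, hF₀, hSW⟩ := hRED F
  exact ⟨B F₀, map_mem_of_mem_span_balanced_fun CR CS Ap Am B ωp' ωm' hc₁ hc₃ hAm hAp hBp hBm N h1 hNp hNm (hFFT F₀ hF₀), hSW⟩

end Unbundled

end Summit.HodgeConjecture.HodgeConjecture.Cruxes.HLiu418.K2LiuLocalThetaCyclicUniform
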